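import Literature.MathematicalPhysics.QuantumFieldTheory.Balaban1983to89.T4EMLTangentInjective
import Literature.MathematicalPhysics.QuantumFieldTheory.Balaban1983to89.BlockAveragingEMLHaarAC
import Summits.QuantumFields.YangMills.Theorems.BalabanUVNodesN09AveragingAEContinuous
import Summits.QuantumFields.YangMills.Theorems.ReplicaVarianceTiltHeightChiSqLEmlInjectivity
import HarnessLib

/-!
# `FluctuationComparisonRegPrIntLS1aCellMapExtendedAverage` — THE EXTENDED EXP-MEAN-LOG AVERAGE ON THE `1∕2`-GUARD (`SU(2)`-VALUED, `= eml` THERE, `=` THE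
# TREE'S GUARDED AVERAGE ON ITS `δ`-GUARD) AND THE CELL MAPS OF ONE UNCUT (0.4) STEP: agreement with `avgFun` on the guard cell, continuity at the cell's
# CLOSURE, measurability, locality and the one-variable NORMAL FORM `Kmat` in the private coordinate

Cell `ym3-torus` (HUMAN RULING D-0037: rung R3 = continuum SU(2) Yang–Mills on T³ — NOT d = 4, NOT infinite volume, NOT a mass gap, NOT Clay), WIDTH COPY «width 17»
of ym3-torus-p1, seat `ym3-torus-px17` gen 21; `--kind proof --supports stmt-QuantumFields-20520 --as helper` (count-neutral).  THEOREMS ONLY (no `def`, no `sorry`,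
no `instance`, no `notation`, default heartbeats).  FILE (F3′) of the seat's 12:58Z INTENT ∕ 13:14Z re-cut (S1aᴴ `RunClassMembershipH` conjunct (c) at the ANCHOR
heights, local-face road on the FULL guard): the full-guard tangent injectivity the INTENT called (F3) is ALREADY lit ✓`T4EMLTangentInjective.emlD_tangent_injective`
(pub-balaban T4-D.G-EML-K3-N°, general `N`, guard `< 1∕2`, `Σcᵢ < 1`) — this file supplies only what the CELL decomposition of one uncut step needs on top of it.

WHY.  The typed (0.4) averaging `avgFun ℰp` ([Balaban1987RG1] (0.4) p. 253; lit `BlockAveraging` §3) JUMPS across the guard spheres `dist1 (loopHol U c i) = δ`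
(`δ = deltaSU (Fin 2) = 1∕3`): `corr = ℰ.avg (loopHol U c)` on `Small U c`, `= 1` off it.  Reading `(avgFun ℰp)_*(ρ·dU)` for CONTINUITY at the uncut heights splits
`ρ` over the `2^{#PBond}` GUARD CELLS `C_s = {U | ∀ c, Small U c ↔ c ∈ s}` and replaces, on each cell, the discontinuous `avgFun` by a CELL MAP that is smooth on a
NEIGHBOURHOOD OF THE CLOSED CELL — which needs the exp-mean-log formula as an `SU(2)`-valued map slightly BEYOND the `1∕3`-guard.  §1: `eml{W_i} ∈ SU(2)` for
`‖W_i − 1‖ < 1∕2` (skew-adjointness of `log` up to `1∕2`, lit ✓`T4EMLTangentInjective.star_mlog_of_unitary`; `|tr log W| ≤ 2‖log W‖ < 2 ln 2 < 2π`).  §2: hence an EXTENDED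
AVERAGE `E` exists — measurable, `= eml` on the `1∕2`-guard, `= expMeanLogSU.avg` on the `δ`-guard, continuous on the `1∕2`-guard (stated `∃ E`, def-free; consumers
`obtain` it once).  §3: for ANY such `E` and any cell index `s`, the CELL MAP `U ↦ (c ↦ (if c ∈ s then E (loopHol U c) else 1) · U(c))` agrees with `avgFun ℰp` ON
`C_s`, is measurable, is CONTINUOUS at every `U₀` whose `s`-families lie in the `1∕2`-guard (⊇ the closed cell), is LOCAL in the private coordinates (lit
✓`BlockAveragingHaarAC` FACT (A)), and along the private coordinate of `c ∈ s` it IS the matrix map `Kmat (offHol U c) (|I|⁻¹) W`, `W = pre·g·post` of lit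
✓`T4EMLTangentInjective` — so that `hasStrictFDerivAt_Kmat` ∕ `emlD_tangent_injective` ∕ pub-ymgap's `kmat_mem_unitaryGroup` apply to it VERBATIM on the full closed guard.

CONTENT (namespace `Summit.QuantumFields.YangMills.Theorems.FluctuationComparisonRegPrIntLS1aCellMapExtendedAverage`; `SU2 = Matrix.specialUnitaryGroup (Fin 2) ℂ`).
* §1 ★`eml_mem_unitaryGroup_of_lt_half`, ★★`eml_mem_specialUnitaryGroup_of_lt_half` (`tr log = 0` on the `1∕2`-guard is ym-line ✓`HeightChiSqLEmlInjectivity.trace_mlog_eq_zero_of_lt_half`, by name).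
* §2 `isOpen_halfGuard`, `measurableSet_halfGuard`, ★★★`exists_extendedAverage` (`∃ E`, measurable ∧ `= eml` on the `1∕2`-guard ∧ `= expMeanLogSU.avg` on the `δ`-guard ∧
  `ContinuousOn` the `1∕2`-guard).
* §3 (any `E` with the two agreement clauses; `s : Finset (PBond P (j+1))`, membership decided by the tree's global `instDecidableEqPBond`; standing range `j + 1 ≤ m + K` where locality is used): ★★`cellMap_eq_avgFun_of_cell`,
  `measurable_cellMap`, ★★`continuousAt_cellMap`, `cellMap_update_centralBond_of_ne` (locality), ★★`cellMap_update_centralBond_self` (fibre formula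
  `(if c ∈ s then E (fibreFamily U c W) else 1) · W`), `coe_E_fibreFamily_eq_exp_sum`, ★★★`coe_cellMap_update_centralBond_self_eq_kmat` (the `Kmat` normal form on the
  `1∕2`-window, `c ∈ s`), `cellMap_update_centralBond_self_of_not_mem` (`= W`, `c ∉ s`).

AS PRINTED vs AS TYPED (★p1).  Print never leaves the guard («defined for configurations close to the identity», p. 253); the cells and the extension are artefacts of the
tree's TOTAL guarded map (row T4-D.L) needed only because S1aᴴ (c) asks continuity of UNCUT densities (`Lines/runpair_organ.lean` :564–:579, `Ts` arbitrary).  Nothing of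
Bałaban's analysis is asserted or proved.

HONEST FRAMING.  Bookkeeping over lit `BlockAveraging*`, `ExpMeanLog`, `MatrixLog`, `T4EMLTangentInjective`; S1aᴴ (c) at the anchor heights NOT closed by this file ((F4) px20
g22, (F5)–(F6) remain); (m), (a), S1aᴴ, 26243, S2β, the five registered stubs of `Lines/semiclassical_s2beta.lean`, crux 20520 ∕ 19936 ∕ 19200 and `YM3TorusSU2` NOT
proved; no registered stub closed; registry untouched; rung R3 = SU(2) YM₃ on T³ at fixed lattice data — NOT d = 4, NOT infinite volume, NOT a mass gap, NOT Clay; the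
Yang–Mills mass gap is NOT proved by any of this.
References: [Balaban1987RG1] CMP 109 (1987) (0.4), (0.9) p. 253; [Balaban1985Averaging] CMP 98 (1985) (21)–(27) pp. 21–22.
-/

set_option autoImplicit false

noncomputable section

namespace Summit.QuantumFields.YangMills.Theorems.FluctuationComparisonRegPrIntLS1aCellMapExtendedAverage

open NormedSpace Set Function Filter Topology MeasureTheory
open scoped Matrix.Norms.L2Operator Matrix
open Literature.MathematicalPhysics.QuantumFieldTheory.Balaban1983to89
open T4Continuum AveragingRT BlockAveraging BlockAveragingHaarAC BlockAveragingEMLHaarAC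
open ExpMeanLog (eml eml_eq_exp expMeanLogSU deltaSU deltaSU_pos lt_third_of_lt_deltaSU)
open MatrixLog (mlog mlog_one exp_mlog norm_mlog_le_two_mul)

/-! ## §1 `eml` is `SU(2)`-valued on the `1∕2`-guard -/

section Membership

/-- ★ **(0.9) on `U(2)` up to the `1∕2`-guard**: for unitary `2 × 2` matrices `W_i` with `‖W_i − 1‖ < 1∕2`, `eml{W_i}` is unitary (each `log W_i` is skew-Hermitian,
lit ✓`T4EMLTangentInjective.star_mlog_of_unitary`). [cite: Balaban1987RG1, (0.9) p.253] -/
theorem eml_mem_unitaryGroup_of_lt_half {ι : Type*} [Fintype ι] {W : ι → Matrix (Fin 2) (Fin 2) ℂ}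
    (hW : ∀ i, W i ∈ Matrix.unitaryGroup (Fin 2) ℂ) (hs : ∀ i, ‖W i - 1‖ < 1 / 2) :
    eml W ∈ Matrix.unitaryGroup (Fin 2) ℂ := by
  letI : NormedAlgebra ℚ (Matrix (Fin 2) (Fin 2) ℂ) := NormedAlgebra.restrictScalars ℚ ℂ _
  set M : Matrix (Fin 2) (Fin 2) ℂ := ((Fintype.card ι : ℂ))⁻¹ • ∑ i, mlog (W i) with hM_def
  have hM : star M = -M := by
    simp only [hM_def, star_smul, star_sum, star_inv₀, star_natCast,
      T4EMLTangentInjective.star_mlog_of_unitary (hW _) (hs _), Finset.sum_neg_distrib, smul_neg]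
  rw [eml_eq_exp, ← hM_def, Matrix.mem_unitaryGroup_iff, star_exp, hM,
    ← exp_add_of_commute (Commute.refl M).neg_right, add_neg_cancel, exp_zero]

/-- ★★ **(0.9) on `SU(2)` up to the `1∕2`-guard**: for `W_i ∈ SU(2)` with `‖W_i − 1‖ < 1∕2`, `eml{W_i} ∈ SU(2)` — the `SU(2)`-valued extension of the printed average across the
boundary of the tree's `1∕3`-guard. [cite: Balaban1987RG1, (0.9) p.253] -/
theorem eml_mem_specialUnitaryGroup_of_lt_half {ι : Type*} [Fintype ι] {W : ι → Matrix (Fin 2) (Fin 2) ℂ}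
    (hW : ∀ i, W i ∈ Matrix.specialUnitaryGroup (Fin 2) ℂ) (hs : ∀ i, ‖W i - 1‖ < 1 / 2) :
    eml W ∈ Matrix.specialUnitaryGroup (Fin 2) ℂ := by
  rw [Matrix.mem_specialUnitaryGroup_iff]
  refine ⟨eml_mem_unitaryGroup_of_lt_half (fun i => (Matrix.mem_specialUnitaryGroup_iff.1 (hW i)).1) hs, ?_⟩
  rw [eml_eq_exp, Literature.Analysis.Matrix.det_exp_eq_exp_trace, Matrix.trace_smul, Matrix.trace_sum,
    Finset.sum_eq_zero fun i _ => HeightChiSqLEmlInjectivity.trace_mlog_eq_zero_of_lt_half (hW i) (hs i), smul_zero, exp_zero]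

end Membership

/-! ## §2 The extended average exists: measurable, `= eml` on the `1∕2`-guard, `= expMeanLogSU.avg` on the `δ`-guard, continuous on the `1∕2`-guard -/

section Extended

variable {ι : Type*} [Fintype ι]

/-- The `1∕2`-guard of a family is open. [folklore] -/
theorem isOpen_halfGuard :
    IsOpen {W : ι → Matrix.specialUnitaryGroup (Fin 2) ℂ | ∀ i, ‖((W i : Matrix.specialUnitaryGroup (Fin 2) ℂ) : Matrix (Fin 2) (Fin 2) ℂ) - 1‖ < 1 / 2} := by
  rw [Set.setOf_forall]
  exact isOpen_iInter_of_finite fun i =>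
    isOpen_lt ((continuous_subtype_val.comp (continuous_apply i)).sub continuous_const).norm continuous_const

/-- The `1∕2`-guard of a family is measurable. [folklore] -/
theorem measurableSet_halfGuard :
    MeasurableSet {W : ι → Matrix.specialUnitaryGroup (Fin 2) ℂ | ∀ i, ‖((W i : Matrix.specialUnitaryGroup (Fin 2) ℂ) : Matrix (Fin 2) (Fin 2) ℂ) - 1‖ < 1 / 2} := by
  rw [Set.setOf_forall]
  exact MeasurableSet.iInter fun i =>
    measurableSet_lt ((continuous_subtype_val.comp (continuous_apply i)).sub continuous_const).norm.measurable measurable_const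

/-- ★★★ **THE EXTENDED EXP-MEAN-LOG AVERAGE EXISTS.**  There is a map `E : (ι → SU(2)) → SU(2)` which is measurable, EQUALS the printed `eml` on the `1∕2`-guard
`‖W_i − 1‖ < 1∕2`, EQUALS the tree's guarded average `expMeanLogSU.avg` on its `δ`-guard `dist1 W_i < δ_{SU(2)}` (`= 1∕3`), and is CONTINUOUS on the `1∕2`-guard (there it is
`exp(|I|⁻¹ Σ_i log W_i)`, the series logarithm being continuous on `‖X − 1‖ < 1`).  Stated `∃ E` (no definition is introduced; a consumer obtains `E` once).
[cite: Balaban1987RG1, (0.4) and (0.9) p.253] -/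
theorem exists_extendedAverage [Nonempty ι] :
    ∃ E : (ι → Matrix.specialUnitaryGroup (Fin 2) ℂ) → Matrix.specialUnitaryGroup (Fin 2) ℂ,
      Measurable E ∧
      (∀ W, (∀ i, ‖((W i : Matrix.specialUnitaryGroup (Fin 2) ℂ) : Matrix (Fin 2) (Fin 2) ℂ) - 1‖ < 1 / 2) →
        ((E W : Matrix.specialUnitaryGroup (Fin 2) ℂ) : Matrix (Fin 2) (Fin 2) ℂ) =
          eml fun i => ((W i : Matrix.specialUnitaryGroup (Fin 2) ℂ) : Matrix (Fin 2) (Fin 2) ℂ)) ∧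
      (∀ W, (∀ i, dist1 (W i) < deltaSU (Fin 2)) → E W = (expMeanLogSU (n := Fin 2)).avg W) ∧
      ContinuousOn E {W | ∀ i, ‖((W i : Matrix.specialUnitaryGroup (Fin 2) ℂ) : Matrix (Fin 2) (Fin 2) ℂ) - 1‖ < 1 / 2} := by
  classical
  letI : NormedAlgebra ℚ (Matrix (Fin 2) (Fin 2) ℂ) := NormedAlgebra.restrictScalars ℚ ℂ _
  set s : Set (ι → Matrix.specialUnitaryGroup (Fin 2) ℂ) :=
    {W | ∀ i, ‖((W i : Matrix.specialUnitaryGroup (Fin 2) ℂ) : Matrix (Fin 2) (Fin 2) ℂ) - 1‖ < 1 / 2} with hs_def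
  -- the extension, as a term
  let E : (ι → Matrix.specialUnitaryGroup (Fin 2) ℂ) → Matrix.specialUnitaryGroup (Fin 2) ℂ := fun W =>
    if h : ∀ i, ‖((W i : Matrix.specialUnitaryGroup (Fin 2) ℂ) : Matrix (Fin 2) (Fin 2) ℂ) - 1‖ < 1 / 2 then
      ⟨eml fun i => ((W i : Matrix.specialUnitaryGroup (Fin 2) ℂ) : Matrix (Fin 2) (Fin 2) ℂ),
        eml_mem_specialUnitaryGroup_of_lt_half (fun i => (W i).2) h⟩
    else 1
  have hEeml : ∀ W, (∀ i, ‖((W i : Matrix.specialUnitaryGroup (Fin 2) ℂ) : Matrix (Fin 2) (Fin 2) ℂ) - 1‖ < 1 / 2) →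
      ((E W : Matrix.specialUnitaryGroup (Fin 2) ℂ) : Matrix (Fin 2) (Fin 2) ℂ) =
        eml fun i => ((W i : Matrix.specialUnitaryGroup (Fin 2) ℂ) : Matrix (Fin 2) (Fin 2) ℂ) := by
    intro W hW
    simp only [E, dif_pos hW]
  have hEoff : ∀ W, W ∉ s → E W = 1 := by
    intro W hW
    have hW' : ¬ ∀ i, ‖((W i : Matrix.specialUnitaryGroup (Fin 2) ℂ) : Matrix (Fin 2) (Fin 2) ℂ) - 1‖ < 1 / 2 := hW
    simp only [E, dif_neg hW']
  -- continuity on the guard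
  have hco : ∀ i, Continuous fun W : ι → Matrix.specialUnitaryGroup (Fin 2) ℂ =>
      ((W i : Matrix.specialUnitaryGroup (Fin 2) ℂ) : Matrix (Fin 2) (Fin 2) ℂ) - 1 := fun i =>
    (continuous_subtype_val.comp (continuous_apply i)).sub continuous_const
  have hcont : ContinuousOn E s := by
    refine Topology.IsInducing.subtypeVal.continuousOn_iff.2 ?_
    have hlog : ∀ i, ContinuousOn (fun W : ι → Matrix.specialUnitaryGroup (Fin 2) ℂ =>
        mlog ((W i : Matrix.specialUnitaryGroup (Fin 2) ℂ) : Matrix (Fin 2) (Fin 2) ℂ)) s :=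
      fun i => Literature.Analysis.Complex.continuousOn_logOnePlus_comp (hco i).continuousOn fun W hW =>
        (hW i).trans (by norm_num)
    have hexp : ContinuousOn (fun W : ι → Matrix.specialUnitaryGroup (Fin 2) ℂ =>
        exp (((Fintype.card ι : ℂ))⁻¹ • ∑ i, mlog ((W i : Matrix.specialUnitaryGroup (Fin 2) ℂ) : Matrix (Fin 2) (Fin 2) ℂ))) s :=
      exp_continuous.comp_continuousOn ((continuousOn_finsetSum Finset.univ fun i _ => hlog i).fun_const_smul _)
    refine hexp.congr fun W hW => ?_
    show ((E W : Matrix.specialUnitaryGroup (Fin 2) ℂ) : Matrix (Fin 2) (Fin 2) ℂ) = _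
    rw [hEeml W hW, eml_eq_exp]
  -- measurability: continuous on the open guard, constant off it
  have hmeas : Measurable E := by
    have hcont' : ContinuousOn E sᶜ := continuousOn_const.congr fun W hW => hEoff W hW
    have hpw := ContinuousOn.measurable_piecewise hcont hcont' (isOpen_halfGuard (ι := ι)).measurableSet
    rwa [Set.piecewise_same] at hpw
  -- agreement with the guarded average on the `δ`-guard
  have hEavg : ∀ W, (∀ i, dist1 (W i) < deltaSU (Fin 2)) → E W = (expMeanLogSU (n := Fin 2)).avg W := by
    intro W hW
    have hW' : ∀ i, ‖((W i : Matrix.specialUnitaryGroup (Fin 2) ℂ) : Matrix (Fin 2) (Fin 2) ℂ) - 1‖ < 1 / 2 :=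
      fun i => (lt_third_of_lt_deltaSU (hW i)).trans (by norm_num)
    apply Subtype.ext
    rw [hEeml W hW', coe_avg_expMeanLogSU W hW, eml_eq_exp]
  exact ⟨E, hmeas, hEeml, hEavg, hcont⟩

end Extended

/-! ## §3 The cell maps of one (0.4) step -/

section CellMap

variable {P : Params} {j : ℕ}
variable (E : (Idx P → Matrix.specialUnitaryGroup (Fin 2) ℂ) → Matrix.specialUnitaryGroup (Fin 2) ℂ)
variable (s : Finset (PBond P (j + 1)))

/-- ★★ **ON THE GUARD CELL THE CELL MAP IS THE TYPED AVERAGING.**  If `E` agrees with `expMeanLogSU.avg` on the `δ`-guard and `U` lies in the cell `C_s`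
(`Small U c ↔ c ∈ s` for every coarse bond), then `(c ↦ (if c ∈ s then E (loopHol U c) else 1) · U(c)) = avgFun ℰp U`. [cite: Balaban1987RG1, (0.4) p.253] -/
theorem cellMap_eq_avgFun_of_cell
    (hEavg : ∀ W, (∀ i, dist1 (W i) < deltaSU (Fin 2)) → E W = (expMeanLogSU (n := Fin 2)).avg W)
    {U : GaugeField P j (Matrix.specialUnitaryGroup (Fin 2) ℂ)} (hU : ∀ c, Small (expMeanLogSU (n := Fin 2)) U c ↔ c ∈ s) :
    (fun c => (if c ∈ s then E (loopHol U c) else 1) * axialAvg U c) = avgFun (expMeanLogSU (n := Fin 2)) U := by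
  funext c
  show _ = corr (expMeanLogSU (n := Fin 2)) U c * axialAvg U c
  unfold corr
  by_cases hc : c ∈ s
  · have hS : Small (expMeanLogSU (n := Fin 2)) U c := (hU c).2 hc
    rw [if_pos hc, if_pos hS, hEavg _ hS]
  · have hS : ¬ Small (expMeanLogSU (n := Fin 2)) U c := fun h => hc ((hU c).1 h)
    rw [if_neg hc, if_neg hS]

/-- The cell map is measurable (for a measurable `E`). [folklore] -/
theorem measurable_cellMap (hEm : Measurable E) :
    Measurable fun U : GaugeField P j (Matrix.specialUnitaryGroup (Fin 2) ℂ) =>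
      fun c => (if c ∈ s then E (loopHol U c) else 1) * axialAvg U c := by
  refine measurable_pi_lambda _ fun c => ?_
  by_cases hc : c ∈ s
  · simp only [if_pos hc]
    exact (hEm.comp (measurable_loopHol c)).mul ((measurable_pi_apply c).comp measurable_axialAvg)
  · simp only [if_neg hc, one_mul]
    exact (measurable_pi_apply c).comp measurable_axialAvg

/-- The family of loop variables at `c` depends continuously on the configuration (lit ✓`BlockAveraging.continuous_holAt`, coordinatewise). [folklore] -/
theorem continuous_loopHol_family (c : PBond P (j + 1)) :
    Continuous fun U : GaugeField P j (Matrix.specialUnitaryGroup (Fin 2) ℂ) => loopHol U c :=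
  continuous_pi fun i =>
    (BlockAveraging.continuous_holAt (n := Fin 2) _ :
      Continuous fun U : GaugeField P j (Matrix.specialUnitaryGroup (Fin 2) ℂ) => loopHol U c i)

/-- ★★ **THE CELL MAP IS CONTINUOUS AT EVERY CONFIGURATION WHOSE `s`-FAMILIES LIE IN THE `1∕2`-GUARD** — in particular at every point of the CLOSED cell
`{∀ c ∈ s, ∀ i, dist1 ≤ 1∕3} ∩ {∀ c ∉ s, ∃ i, dist1 ≥ 1∕3}` — provided `E` is continuous on the `1∕2`-guard. [cite: Balaban1987RG1, (0.4) p.253 (bookkeeping)] -/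
theorem continuousAt_cellMap
    (hEc : ContinuousOn E {W | ∀ i, ‖((W i : Matrix.specialUnitaryGroup (Fin 2) ℂ) : Matrix (Fin 2) (Fin 2) ℂ) - 1‖ < 1 / 2})
    {U₀ : GaugeField P j (Matrix.specialUnitaryGroup (Fin 2) ℂ)}
    (hU₀ : ∀ c ∈ s, ∀ i, ‖((loopHol U₀ c i : Matrix.specialUnitaryGroup (Fin 2) ℂ) : Matrix (Fin 2) (Fin 2) ℂ) - 1‖ < 1 / 2) :
    ContinuousAt (fun U : GaugeField P j (Matrix.specialUnitaryGroup (Fin 2) ℂ) =>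
      fun c => (if c ∈ s then E (loopHol U c) else 1) * axialAvg U c) U₀ := by
  refine continuousAt_pi.2 fun c => ?_
  by_cases hc : c ∈ s
  · simp only [if_pos hc]
    have hE : ContinuousAt (fun U : GaugeField P j (Matrix.specialUnitaryGroup (Fin 2) ℂ) => E (loopHol U c)) U₀ :=
      ContinuousAt.comp (f := fun U : GaugeField P j (Matrix.specialUnitaryGroup (Fin 2) ℂ) => loopHol U c) (x := U₀)
        (hEc.continuousAt (isOpen_halfGuard.mem_nhds (hU₀ c hc))) (continuous_loopHol_family c).continuousAt
    exact hE.mul (Summit.QuantumFields.YangMills.BalabanUVNodes.N09AveragingAEContinuous.continuous_axialAvg_apply c).continuousAt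
  · simp only [if_neg hc, one_mul]
    exact (Summit.QuantumFields.YangMills.BalabanUVNodes.N09AveragingAEContinuous.continuous_axialAvg_apply c).continuousAt


/-- LOCALITY: the cell map's component at `c′ ≠ c` does not see the private coordinate `U(β(c))` (lit ✓`BlockAveragingHaarAC` FACT (A)). [folklore] -/
theorem cellMap_update_centralBond_of_ne (hj : j + 1 ≤ P.m + P.K) (U : GaugeField P j (Matrix.specialUnitaryGroup (Fin 2) ℂ))
    (c c' : PBond P (j + 1)) (hc : c' ≠ c) (g : Matrix.specialUnitaryGroup (Fin 2) ℂ) :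
    (if c' ∈ s then E (loopHol (update U (centralBond c) g) c') else 1) * axialAvg (update U (centralBond c) g) c' =
      (if c' ∈ s then E (loopHol U c') else 1) * axialAvg U c' := by
  rw [loopHol_update_centralBond hj U c c' hc g, axialAvg_update_centralBond_of_ne hj U c c' hc g]

/-- ★★ **THE FIBRE FORMULA**: along the private coordinate `g = U(β(c))`, the cell map's own component is `(if c ∈ s then E (fibreFamily U c W) else 1) · W` with
`W = pre·g·post` (lit ✓`BlockAveragingEMLHaarAC.loopHol_update_centralBond_self`, ✓`BlockAveragingHaarAC.axialAvg_update_centralBond`). [cite: Balaban1987RG1, (0.4) p.253 (bookkeeping)] -/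
theorem cellMap_update_centralBond_self (hj : j + 1 ≤ P.m + P.K) (U : GaugeField P j (Matrix.specialUnitaryGroup (Fin 2) ℂ))
    (c : PBond P (j + 1)) (g : Matrix.specialUnitaryGroup (Fin 2) ℂ) :
    (if c ∈ s then E (loopHol (update U (centralBond c) g) c) else 1) * axialAvg (update U (centralBond c) g) c =
      (if c ∈ s then E (fibreFamily U c (pre U c * g * post U c)) else 1) * (pre U c * g * post U c) := by
  rw [loopHol_update_centralBond_self hj, axialAvg_update_centralBond hj]

/-- On the `1∕2`-window, `↑(E (fibreFamily U c W)) = exp(Σ_k |I|⁻¹ log(h_k W*))` over the enumerated off-central open holonomies (central terms drop out: `log 1 = 0`;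
lit ✓`BlockAveragingEMLHaarAC.sum_mlog_fibreFamily`). [cite: Balaban1987RG1, (0.4) p.253] -/
theorem coe_E_fibreFamily_eq_exp_sum
    (hEeml : ∀ W, (∀ i, ‖((W i : Matrix.specialUnitaryGroup (Fin 2) ℂ) : Matrix (Fin 2) (Fin 2) ℂ) - 1‖ < 1 / 2) →
      ((E W : Matrix.specialUnitaryGroup (Fin 2) ℂ) : Matrix (Fin 2) (Fin 2) ℂ) =
        eml fun i => ((W i : Matrix.specialUnitaryGroup (Fin 2) ℂ) : Matrix (Fin 2) (Fin 2) ℂ))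
    (U : GaugeField P j (Matrix.specialUnitaryGroup (Fin 2) ℂ)) (c : PBond P (j + 1)) {W : Matrix.specialUnitaryGroup (Fin 2) ℂ}
    (hW : ∀ i, ‖((fibreFamily U c W i : Matrix.specialUnitaryGroup (Fin 2) ℂ) : Matrix (Fin 2) (Fin 2) ℂ) - 1‖ < 1 / 2) :
    ((E (fibreFamily U c W) : Matrix.specialUnitaryGroup (Fin 2) ℂ) : Matrix (Fin 2) (Fin 2) ℂ) =
      exp (∑ k : Fin (offCard c), ((emlWeight P : ℝ) : ℂ) •
        mlog (((offHol U c k : Matrix.specialUnitaryGroup (Fin 2) ℂ) : Matrix (Fin 2) (Fin 2) ℂ) * star (W : Matrix (Fin 2) (Fin 2) ℂ))) := by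
  have hw : ((emlWeight P : ℝ) : ℂ) = ((Fintype.card (Idx P) : ℂ))⁻¹ := by
    rw [emlWeight, Complex.ofReal_inv, Complex.ofReal_natCast]
  rw [hEeml _ hW, eml_eq_exp, sum_mlog_fibreFamily U c W, Finset.smul_sum, hw]

/-- ★★★ **THE `Kmat` NORMAL FORM OF THE CELL MAP'S FIBRE MAP** (`c ∈ s`, `1∕2`-window): `↑(cellMap (U[β(c) ↦ g]) c) = Kmat (↑offHol U c) (|I|⁻¹) ↑W`, `W = pre·g·post` —
the matrix map of lit ✓`T4EMLTangentInjective` (`hasStrictFDerivAt_Kmat`, `emlD_tangent_injective`, weights `emlWeight` of total `m∕|I| < 1`, ✓`sum_emlWeight_lt_one`).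
[cite: Balaban1987RG1, (0.4) p.253] -/
theorem coe_cellMap_update_centralBond_self_eq_kmat (hj : j + 1 ≤ P.m + P.K)
    (hEeml : ∀ W, (∀ i, ‖((W i : Matrix.specialUnitaryGroup (Fin 2) ℂ) : Matrix (Fin 2) (Fin 2) ℂ) - 1‖ < 1 / 2) →
      ((E W : Matrix.specialUnitaryGroup (Fin 2) ℂ) : Matrix (Fin 2) (Fin 2) ℂ) =
        eml fun i => ((W i : Matrix.specialUnitaryGroup (Fin 2) ℂ) : Matrix (Fin 2) (Fin 2) ℂ))
    (U : GaugeField P j (Matrix.specialUnitaryGroup (Fin 2) ℂ)) {c : PBond P (j + 1)} (hc : c ∈ s) (g : Matrix.specialUnitaryGroup (Fin 2) ℂ)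
    (hW : ∀ i, ‖((fibreFamily U c (pre U c * g * post U c) i : Matrix.specialUnitaryGroup (Fin 2) ℂ) : Matrix (Fin 2) (Fin 2) ℂ) - 1‖ < 1 / 2) :
    (((if c ∈ s then E (loopHol (update U (centralBond c) g) c) else 1) * axialAvg (update U (centralBond c) g) c :
        Matrix.specialUnitaryGroup (Fin 2) ℂ) : Matrix (Fin 2) (Fin 2) ℂ) =
      T4EMLTangentInjective.Kmat (fun k : Fin (offCard c) => ((offHol U c k : Matrix.specialUnitaryGroup (Fin 2) ℂ) : Matrix (Fin 2) (Fin 2) ℂ))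
        (fun _ => emlWeight P) ((pre U c * g * post U c : Matrix.specialUnitaryGroup (Fin 2) ℂ) : Matrix (Fin 2) (Fin 2) ℂ) := by
  rw [cellMap_update_centralBond_self E s hj, if_pos hc, Submonoid.coe_mul, coe_E_fibreFamily_eq_exp_sum E hEeml U c hW,
    T4EMLTangentInjective.Kmat]

/-- For `c ∉ s` the cell map's fibre map is the translation `g ↦ pre·g·post` (the axial branch). [folklore] -/
theorem cellMap_update_centralBond_self_of_not_mem (hj : j + 1 ≤ P.m + P.K) (U : GaugeField P j (Matrix.specialUnitaryGroup (Fin 2) ℂ))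
    {c : PBond P (j + 1)} (hc : c ∉ s) (g : Matrix.specialUnitaryGroup (Fin 2) ℂ) :
    (if c ∈ s then E (loopHol (update U (centralBond c) g) c) else 1) * axialAvg (update U (centralBond c) g) c = pre U c * g * post U c := by
  rw [cellMap_update_centralBond_self E s hj, if_neg hc, one_mul]

end CellMap

end Summit.QuantumFields.YangMills.Theorems.FluctuationComparisonRegPrIntLS1aCellMapExtendedAverage

end
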